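import Literature.Claims.NS.Guevremont2026
import Summits.NavierStokesRegularity.NavierStokesRegularity.Theorems.SoloRefuteRomanMiller2011
import Summits.NavierStokesRegularity.NavierStokesRegularity.Theorems.SoloRefuteGuevremont2026Energy
import HarnessLib

-- FILER'S DISCLOSED DEDUP EDIT (salvage-p1 g4, conv. (b)): the kit's `isDatum_zero` restated the landed
-- `…Theorems.Guevremont2026Energy.isDatum_zero` (p538183); it is deleted and the landed one is used by name.
-- All other declarations are byte-identical to typist-4 g6's kit 12cccbb1942031ed.

/-!
# C143 `Guevremont2026` — the off-path face `ClaimedUniqueness` is false AS TYPED (custodian kit, typist-4 g6)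

`Literature.Claims.NS.Guevremont2026.ClaimedUniqueness` types the word «unique» of the abstract p.1 l.11 for
global smooth solutions of (1)–(2) on `ℝ³` from a datum of the printed class, with NO growth / energy / decay
condition on the solution (none is printed; the typist's docstring records the classical non-uniqueness
family). At that width the statement is false in the kernel: from the ZERO datum (smooth, divergence-free,
in every `H^s` — the file's own `inHs_of_hasRapidSpatialDecay`) both the rest state `u ≡ 0`, `p ≡ 0`
(`RomanMiller2011.stream 0`) and the uniformly accelerating stream `u(t,x) = t·e₀`, `p(t,x) = −x₀`
(`RomanMiller2011.stream id`, `streamPressure id`) are global classical solutions for every `ν`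
(`isClassicalNSSolutionOn_stream`), and they differ at `t = 1`. Records-grade: `ClaimedUniqueness` is «not
consumed by the chain» (skeleton docstring); the head of #131 (`Step3_EnstrophyLaw`, by
`…Theorems.Guevremont2026.not_Step3_EnstrophyLaw` p525680) and its class are untouched; nothing is re-keyed.
Sibling of the CLAY-LINK keeper's `SoloRefuteGuevremont2026Energy` (same witness, energy face).

WHAT THIS IS NOT: not a claim about NS regularity or blow-up; not a claim about any author beyond the
typed locator.
-/

set_option linter.dupNamespace false

noncomputable section

open Set Function MeasureTheory
open scoped ContDiff ENNReal
open Literature.Analysis.FluidPDE Literature.Claims.NS.Guevremont2026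
open Summit.NavierStokesRegularity.NavierStokesRegularity.Theorems.RomanMiller2011
  (e0 stream streamPressure isClassicalNSSolutionOn_stream)

namespace Summit.NavierStokesRegularity.NavierStokesRegularity.Theorems.Guevremont2026Uniqueness

/-- Every stream `g(t)·e₀` with `g(0) = 0` starts from the zero datum. [folklore] -/
theorem stream_zero_of {g : ℝ → ℝ} (hg : g 0 = 0) : stream g 0 = 0 := by
  funext x
  simp [stream, hg]

/-- A stream with smooth profile `g`, `g(0) = 0`, is a «global smooth solution» of the class from the zero
datum, for every `ν`. [folklore] -/
theorem isGlobalSolution_stream (ν : ℝ) {g : ℝ → ℝ} (hg : ContDiff ℝ ∞ g) (hg0 : g 0 = 0) :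
    IsGlobalSolution ν (0 : E3 → E3) (stream g) (streamPressure g) where
  isClassical :=
    (isClassicalNSSolutionOn_stream hg ν).mono (subset_univ _) (uniqueDiffOn_Ici 0)
  initial := stream_zero_of hg0

/-- At time `1` the rest state and the accelerating stream differ. [folklore] -/
theorem stream_zero_one_ne_stream_id_one : stream (0 : ℝ → ℝ) 1 ≠ stream id 1 := by
  intro h
  have h0 := congrArg (fun f : E3 → E3 => f 0 0) h
  simp [stream, e0] at h0

/-- **`ClaimedUniqueness` as typed is false.** Witness: `ν = 1`, `s = 1`, the zero datum, the rest state
`stream 0` against the accelerating stream `stream id`, `t = 1`. [cite: Guevremont2026, abstract p.1 l.11] -/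
theorem not_claimedUniqueness : ¬ ClaimedUniqueness := by
  intro h
  have h1 := h 1 one_pos 1 (by norm_num) 0
    (Summit.NavierStokesRegularity.NavierStokesRegularity.Theorems.Guevremont2026Energy.isDatum_zero 1)
    (stream 0) (stream id)
    (streamPressure 0) (streamPressure id) (isGlobalSolution_stream 1 contDiff_const rfl)
    (isGlobalSolution_stream 1 contDiff_id rfl) 1 zero_le_one
  exact stream_zero_one_ne_stream_id_one h1

/-- FQN guard: the refuted statement is literally the skeleton's. -/
example : ¬ Literature.Claims.NS.Guevremont2026.ClaimedUniqueness := not_claimedUniqueness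

end Summit.NavierStokesRegularity.NavierStokesRegularity.Theorems.Guevremont2026Uniqueness

end

-- WHAT THIS IS NOT: not a claim about NS regularity or blow-up; not a claim about any author beyond the typed locator.
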